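import Summits.QuantumFields.BalabanUV.T4Continuum.Support.NE7AccumulatedFrameDefectCornerSums
import Summits.QuantumFields.BalabanUV.T4Continuum.Support.NE7QbarIterL2DbarFree
import HarnessLib

/-!
# Support | NE7 (gen 97, ROAD-G97 §5 «corner letters of the REM term»): THE PROP-4-REMAINDER TERM OF THE FRAME DEFECT, SQUARED AND SUMMED OVER THE TOP CORNERS —
# `Σ_{z∈[0,N)^d} L^{−d}Σ_r lnorm(ψ_m − QbarIter L m W X; L^{j+1−m}•z, Γ_r)² ≤ 1024·dL·K²·b²·(L²ρ₂)^{m−1}·l2sq X` at every level `1 ≤ m ≤ j` (`K = C₁covL²√(d(4L+1)^d)`, `ρ₂ = L²∕L^d`; row NE3's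
# ℓ² remainder tower (Γ1) AT EVERY LEVEL, no frame condition) and the assembled ℓ²-over-corners letter of `Σ_{m≤j} PA_m(ψ_m − QbarIter_m X)` with the explicit `(j+1)·Σ_{i<j}(L²ρ₂)^i`

Cell `pub-balaban`, rung (B)+1 sub-cell t4, lineage `b2b-balaban-t4-ne7-p1` (CRUX PROVER NE7 #1 = OWNER of row NE7), generation 97; memo `t4/b2b-balaban-t4-ne7-p1-g97/ROAD-G97.md` §§4–5
(ROAD-Γ′ S3∕S4: the residual top frame reading `f = framePotW X₂` of the exactly top-normalised representative obeys `‖f_z‖ ≤ h_z + Σ_m PA_m(ψ_m − QbarIter_m X)(z)`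
(`NE7AccumulatedFrameDefectLocal.norm_mlog_vcov_sub_framePotW_le_prod`); the corner letters of `h_z` are `NE7AccumulatedFrameDefectCornerSums`; THIS FILE supplies the ℓ² corner letter
of the second summand).  Over this generation's `NE7AccumulatedFrameDefectLocal` (Jensen `pathAvg_sq_le_sqAvg`, `sqAvg_le_blockEnergy`), `NE7AccumulatedFrameDefectCornerSums`
(`sum_periodBox_cornerBlocks_le`), and gen 96's `NE7QbarIterL2DbarFree.sqrt_l2sq_QbarIter_sub_le` ((Γ1)-ℓ²: `√l2sq_{[0,N′)^d}(QbarIter_{i+1} − Ad⁻¹Q_{i+1}) ≤ 32K·√l2sq X·b·(√ρ₂·L)^i`)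
applied with the level `i+1 = m ≤ j` AS THE TOP of its own tower (`N′ = N·L^{j+1−m}`; all regime hypotheses are monotone in the level: `NE3FramePotBoundW.levelSmall_of_le`).

WHY (memo §2 (R3)∕(R4), §4 S4).  The corner spikes that carry `f` inside `X_N` cost `M⁻²·2d·Σ_z‖f_z‖²` in the ν-letter; the rem term's corner sum through the GLOBAL ℓ² remainder tower
is flat in the level in d = 4 (`L²ρ₂ = 1`), so the assembled letter carries `(j+1)·j` — which the spike weight `M⁻² = L^{−2(j+1)}` eats (`j² ≤ L^{2j}`): k-free.  No localisation of the
remainder tower is needed on ROAD-Γ′.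
WHAT ([folklore]; 0 def, 0 sorry).  §1 `lnorm_sub_comm` (the path functional of `A − B` is that of `B − A`), `rem_zero_level` (`ψ_0 = X`: the level-0 term vanishes).
§2 **`sum_corners_sqAvg_rem_le`** (the first display).  §3 **`sum_corners_sq_pathAvg_rem_le`** (`Σ_z(Σ_{m≤j}PA_m(rem_m))² ≤ (j+1)·1024dLK²b²·(Σ_{i<j}(L²ρ₂)^i)·l2sq X`).
HONEST FRAMING (page 1): bookkeeping on OUR frame over landed kernel theorems; nothing of Bałaban's asserted; the ℓ¹ rem letter, S2, S3, `hdecomp♭`, NE7 NOT proved; spine 0∕9; finite T⁴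
rung (B)+1 — NOT infinite volume, NOT mass gap, NOT `BetaPertH`, NOT Clay.  Continuum YM on T⁴ ⇐ BetaPertH ∧ nine spine estimates (0/9 proved); BetaPertH ⇐ (D1) ∧ (D4) ∧ CAP+tail;
G-an2-4 gates asym, D1 and NE2/3/4.
-/

set_option autoImplicit false

open scoped BigOperators Matrix Matrix.Norms.L2Operator
open NormedSpace Finset

namespace Summit.QuantumFields.BalabanUV.T4Continuum.NE7AccumulatedFrameDefectRemCornerSums

open Literature.MathematicalPhysics.QuantumFieldTheory.Balaban1983to89
open B7Prop1Explicit B7Prop2Explicit B7Prop3Flat MatrixLog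
open B7Prop4GeneralLevels (logCovIter)
open T4AveragingDeficitWall (Ad IsUnitaryCfg SmallField)
open T4AveragingDeficitWallBoundary (IsPeriodicCfg periodBox)
open AveragingDeficitPeriodicCounting (IsPeriodicDir)
open AveragingDeficitTransport (lnorm lnorm_cons lnorm_nil norm_Ad_of_unitary)
open AveragingDeficitNearIdentity (lnorm_nonneg Ad_one)
open AveragingDeficitMultiLevelPrep (cavgIter LevelSmall)
open AveragingDeficitMultiLevelBridge (cavgIter_eq_avgIter)
open NE3TangentCovariantTower (QbarIter)
open NE3.QbarDictionary (adField)
open NE3CovariantLineSumsL2 (l2sq l2sq_nonneg)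
open ShellMeasureAverageProp4General (C1cov C1cov_pos)
open NE3FramePotBoundW (levelSmall_of_le)
open NE3GaugeDirFrames (Ad_Ad_inv)
open NE7QbarIterL2DbarFree (sqrt_l2sq_QbarIter_sub_le)
open NE7AccumulatedFrameDefectLocal (pathAvg_sq_le_sqAvg sqAvg_le_blockEnergy)
open NE7AccumulatedFrameDefectCornerSums (sum_periodBox_cornerBlocks_le)

noncomputable section

variable {d : ℕ} {n : Type*} [Fintype n] [DecidableEq n]

/-! ## §1 Two bookkeeping facts -/

/-- The path functional of `A − B` is that of `B − A`. [folklore] -/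
theorem lnorm_sub_comm (A B : Site d → Fin d → Matrix n n ℂ) :
    ∀ (x : Site d) (w : List (Letter d)), lnorm (fun y μ => A y μ - B y μ) x w = lnorm (fun y μ => B y μ - A y μ) x w
  | x, [] => by rw [lnorm_nil, lnorm_nil]
  | x, l :: w => by rw [lnorm_cons, lnorm_cons, lnorm_sub_comm A B (x + l.vec) w, norm_sub_rev]

/-- **THE LEVEL-0 TERM VANISHES**: `ψ_0 = Ad_W⁻¹(Ad_W X) = X = QbarIter L 0 W X`. [folklore] -/
theorem rem_zero_level (L : ℕ) (W : Site d → Fin d → (Matrix n n ℂ)ˣ) (X : Site d → Fin d → Matrix n n ℂ) (x : Site d) (μ : Fin d) :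
    Ad (avgIter L W 0 x μ)⁻¹ (logCovIter L W (adField W X) 0 x μ) - QbarIter L 0 W X x μ = 0 := by
  show Ad (W x μ)⁻¹ (Ad (W x μ) (X x μ)) - X x μ = 0
  rw [← T4AveragingDeficitNonAbelian.Ad_mul, inv_mul_cancel, Ad_one, sub_self]

/-! ## §2 The corner sum of the square path functional of the remainder at one level -/

/-- **CORNER SUM OF `SQ(rem_m)` AGAINST ROW NE3's ℓ² REMAINDER TOWER AT LEVEL `m`**: in the tower class at `W` at the top level `j+1` (hypotheses of
`NE7QbarIterL2DbarFree.sqrt_l2sq_QbarIter_sub_le`), for every `1 ≤ m ≤ j`, with `rem_m := ψ_m − QbarIter L m W X`, `ψ_m = Ad_{W̄^m}⁻¹Q_m`,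
`Σ_{z∈[0,N)^d} L^{−d}Σ_r lnorm(rem_m; L^{j+1−m}•z, Γ_r)² ≤ dL·1024·K²·b²·(L²·(L²∕L^d))^{m−1}·l2sq_{[0,N·L^{j+1})^d} X`, `K = C₁covL²√(d(4L+1)^d)` (Jensen on each corner block, disjointness of the
corner blocks in the level-`m` period box `[0, N·L^{j+1−m})^d`, (Γ1)-ℓ² with the level `m` as the top of its own tower of period `N·L^{j+1−m}`). [folklore] -/
theorem sum_corners_sqAvg_rem_le [Nonempty n] {L N : ℕ} (hL : 2 ≤ L) (hN : 1 ≤ N) (j : ℕ)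
    {W : Site d → Fin d → (Matrix n n ℂ)ˣ} {x : ℝ} (hWu : IsUnitaryCfg W) (hWP : IsPeriodicCfg W ((N * L ^ (j + 1) : ℕ) : ℤ))
    (hx : 0 ≤ x) (hsm : LevelSmall d L j x) (hWx : SmallField W x)
    {α₀ b : ℝ} (hα : 0 < α₀) (hα3 : C0 d * (2 * α₀) ≤ 1 / 3) (hα4 : 4 * (2 * α₀) ≤ c2' d L)
    (h52 : pdev W < α₀ * (((L : ℝ) ^ (j + 1))⁻¹) ^ 2) (hb : 0 ≤ b)
    {X : Site d → Fin d → Matrix n n ℂ} (hX : ∀ (y : Site d) (κ : Fin d), ‖X y κ‖ ≤ b) (hXP : IsPeriodicDir X ((N * L ^ (j + 1) : ℕ) : ℤ))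
    (hsmall : Real.exp (4 * (800 * ((d : ℝ) + 1) ^ 2 * ((d : ℝ) + 4)) * α₀)
      * (1 + 8 * (131072 * ((d : ℝ) + 1) ^ 2) * ((L : ℝ) ^ (j + 1) * b)) ≤ 2)
    (hc₃ : 4 * ((L : ℝ) ^ (j + 1) * b) ≤ c3 d L)
    (hK : 16 * (C1cov d * (L : ℝ) ^ 2 * Real.sqrt (d * (2 * (2 * L) + 1) ^ d)) * (L : ℝ) ^ (j + 1) * b ≤ Real.sqrt ((L : ℝ) ^ 2 / (L : ℝ) ^ d))
    {m : ℕ} (hm1 : 1 ≤ m) (hm : m ≤ j) :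
    ∑ z ∈ periodBox (d := d) N, ((L : ℝ) ^ d)⁻¹ * ∑ r : Fin d → Fin L,
        lnorm (fun x' μ => Ad (avgIter L W m x' μ)⁻¹ (logCovIter L W (adField W X) m x' μ) - QbarIter L m W X x' μ)
          (((L : ℤ) ^ (j + 1 - m)) • z) (treeWord (boxVec L r)) ^ 2
      ≤ ((d : ℝ) * L) * (1024 * (C1cov d * (L : ℝ) ^ 2 * Real.sqrt (d * (2 * (2 * L) + 1) ^ d)) ^ 2 * b ^ 2
          * ((L : ℝ) ^ 2 * ((L : ℝ) ^ 2 / (L : ℝ) ^ d)) ^ (m - 1) * l2sq (periodBox (d := d) (N * L ^ (j + 1))) X) := by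
  letI : CStarAlgebra (Matrix n n ℂ) := {}
  have hL1 : 1 ≤ L := by omega
  have hL0 : (0 : ℝ) < L := by exact_mod_cast (show 0 < L by omega)
  have hL1R : (1 : ℝ) ≤ L := by exact_mod_cast hL1
  -- the level `m = i + 1` as the top of its own tower of period `N' = N·L^{j+1−m}`
  obtain ⟨i, rfl⟩ : ∃ i, m = i + 1 := ⟨m - 1, by omega⟩
  have hij : i ≤ j := by omega
  set P : ℕ := L ^ (j + 1 - (i + 1)) with hPdef
  set N' : ℕ := N * P with hN'def
  have hP1 : 1 ≤ P := Nat.one_le_pow _ L (by omega)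
  have hN'1 : 1 ≤ N' := Nat.one_le_iff_ne_zero.mpr (Nat.mul_ne_zero (by omega) (by omega))
  have hNN : N' * L ^ (i + 1) = N * L ^ (j + 1) := by
    rw [hN'def, hPdef, mul_assoc, ← pow_add]; congr 2; omega
  -- the regime hypotheses at the lower level
  have hpow_le : (L : ℝ) ^ (i + 1) ≤ (L : ℝ) ^ (j + 1) := pow_le_pow_right₀ hL1R (by omega)
  have hlev_le : (L : ℝ) ^ (i + 1) * b ≤ (L : ℝ) ^ (j + 1) * b := mul_le_mul_of_nonneg_right hpow_le hb
  have hWP' : IsPeriodicCfg W ((N' * L ^ (i + 1) : ℕ) : ℤ) := by rw [hNN]; exact hWP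
  have hXP' : IsPeriodicDir X ((N' * L ^ (i + 1) : ℕ) : ℤ) := by rw [hNN]; exact hXP
  have hsm' : LevelSmall d L i x := levelSmall_of_le hij hsm
  have h52' : pdev W < α₀ * (((L : ℝ) ^ (i + 1))⁻¹) ^ 2 := by
    refine lt_of_lt_of_le h52 (mul_le_mul_of_nonneg_left ?_ hα.le)
    have h1 : ((L : ℝ) ^ (j + 1))⁻¹ ≤ ((L : ℝ) ^ (i + 1))⁻¹ := inv_anti₀ (by positivity) hpow_le
    exact pow_le_pow_left₀ (by positivity) h1 2
  have hsmall' : Real.exp (4 * (800 * ((d : ℝ) + 1) ^ 2 * ((d : ℝ) + 4)) * α₀)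
      * (1 + 8 * (131072 * ((d : ℝ) + 1) ^ 2) * ((L : ℝ) ^ (i + 1) * b)) ≤ 2 := by
    refine le_trans (mul_le_mul_of_nonneg_left ?_ (Real.exp_pos _).le) hsmall
    nlinarith [hlev_le]
  have hc₃' : 4 * ((L : ℝ) ^ (i + 1) * b) ≤ c3 d L := by nlinarith [hlev_le]
  have hK' : 16 * (C1cov d * (L : ℝ) ^ 2 * Real.sqrt (d * (2 * (2 * L) + 1) ^ d)) * (L : ℝ) ^ (i + 1) * b ≤ Real.sqrt ((L : ℝ) ^ 2 / (L : ℝ) ^ d) := by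
    have hK0 : 0 ≤ 16 * (C1cov d * (L : ℝ) ^ 2 * Real.sqrt (d * (2 * (2 * L) + 1) ^ d)) := by have := C1cov_pos d; positivity
    refine le_trans ?_ hK
    have := mul_le_mul_of_nonneg_left hlev_le hK0
    nlinarith
  -- (Γ1)-ℓ² at level `i+1` over `periodBox N'`
  have hΓ := sqrt_l2sq_QbarIter_sub_le hL hN'1 i hWu hWP' hx hsm' hWx hα hα3 hα4 h52' hb hX hXP' hsmall' hc₃' hK'
  rw [hNN] at hΓ
  set K : ℝ := C1cov d * (L : ℝ) ^ 2 * Real.sqrt (d * (2 * (2 * L) + 1) ^ d) with hKdef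
  set ρ : ℝ := Real.sqrt ((L : ℝ) ^ 2 / (L : ℝ) ^ d) with hρ
  set E : ℝ := l2sq (periodBox (d := d) (N * L ^ (j + 1))) X with hE
  have hK0 : 0 ≤ K := by rw [hKdef]; have := C1cov_pos d; positivity
  have hE0 : 0 ≤ E := l2sq_nonneg _ _
  have hρ2 : ρ ^ 2 = (L : ℝ) ^ 2 / (L : ℝ) ^ d := Real.sq_sqrt (by positivity)
  -- the remainder field in the orientation of (Γ1), and its square-summed form
  set R : Site d → Fin d → Matrix n n ℂ := fun z κ => QbarIter L (i + 1) W X z κ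
      - Ad ((cavgIter L (i + 1) W) z κ)⁻¹ (logCovIter L W (adField W X) (i + 1) z κ) with hR
  have hl2R : l2sq (periodBox (d := d) N') R ≤ (32 * K * Real.sqrt E * b * (ρ * L) ^ (i + 1 - 1)) ^ 2 := by
    have h0 : 0 ≤ l2sq (periodBox (d := d) N') R := l2sq_nonneg _ _
    have h1 := pow_le_pow_left₀ (Real.sqrt_nonneg _) hΓ 2
    rw [Real.sq_sqrt h0] at h1
    exact h1
  -- our orientation: `rem = ψ − QbarIter = −R` pointwise (up to `cavgIter = avgIter`)
  set rem : Site d → Fin d → Matrix n n ℂ := fun x' μ => Ad (avgIter L W (i + 1) x' μ)⁻¹ (logCovIter L W (adField W X) (i + 1) x' μ) - QbarIter L (i + 1) W X x' μ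
    with hrem
  have hremR : ∀ (y : Site d) (w : List (Letter d)), lnorm rem y w = lnorm R y w := by
    intro y w
    have e : R = fun z κ => QbarIter L (i + 1) W X z κ - Ad (avgIter L W (i + 1) z κ)⁻¹ (logCovIter L W (adField W X) (i + 1) z κ) := by
      funext z κ; simp only [hR]; rw [cavgIter_eq_avgIter]
    rw [e]; exact lnorm_sub_comm _ _ y w
  have hnormR : ∀ (y : Site d) (κ : Fin d), ‖rem y κ‖ = ‖R y κ‖ := by
    intro y κ; simp only [hrem, hR]; rw [cavgIter_eq_avgIter, norm_sub_rev]
  -- Jensen on each corner block, then disjointness of the corner blocks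
  have hLP : L ≤ P := by
    rw [hPdef]
    calc L = L ^ 1 := (pow_one L).symm
      _ ≤ L ^ (j + 1 - (i + 1)) := Nat.pow_le_pow_right (by omega) (by omega)
  have hPz : ∀ z : Site d, (((L : ℤ) ^ (j + 1 - (i + 1))) • z : Site d) = (P : ℤ) • z := fun z => by rw [hPdef]; push_cast; rfl
  have hblock : ∀ z : Site d, ((L : ℝ) ^ d)⁻¹ * ∑ r : Fin d → Fin L, lnorm rem (((L : ℤ) ^ (j + 1 - (i + 1))) • z) (treeWord (boxVec L r)) ^ 2
      ≤ ((d : ℝ) * L) * ∑ v ∈ periodBox (d := d) L, ∑ κ : Fin d, ‖R (((L : ℤ) ^ (j + 1 - (i + 1))) • z + v) κ‖ ^ 2 := by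
    intro z
    have h := sqAvg_le_blockEnergy hL1 rem (((L : ℤ) ^ (j + 1 - (i + 1))) • z)
    refine h.trans (le_of_eq ?_)
    exact congrArg (((d : ℝ) * L) * ·) (Finset.sum_congr rfl fun v _ => Finset.sum_congr rfl fun κ _ => by rw [hnormR])
  have htile : ∑ z ∈ periodBox (d := d) N, ∑ v ∈ periodBox (d := d) L, ∑ κ : Fin d, ‖R (((L : ℤ) ^ (j + 1 - (i + 1))) • z + v) κ‖ ^ 2
      ≤ l2sq (periodBox (d := d) N') R := by
    have h := sum_periodBox_cornerBlocks_le (d := d) hL1 hLP N (g := fun w => ∑ κ : Fin d, ‖R w κ‖ ^ 2)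
      (fun w => Finset.sum_nonneg fun κ _ => sq_nonneg _)
    have e : ∑ z ∈ periodBox (d := d) N, ∑ v ∈ periodBox (d := d) L, ∑ κ : Fin d, ‖R (((L : ℤ) ^ (j + 1 - (i + 1))) • z + v) κ‖ ^ 2
        = ∑ z ∈ periodBox (d := d) N, ∑ v ∈ periodBox (d := d) L, ∑ κ : Fin d, ‖R ((P : ℤ) • z + v) κ‖ ^ 2 :=
      Finset.sum_congr rfl fun z _ => Finset.sum_congr rfl fun v _ => by rw [hPz]
    rw [e]
    refine h.trans (le_of_eq ?_)
    rw [hN'def, Nat.mul_comm N P]; rfl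
  -- assemble
  have hgeo : (ρ * L) ^ (i + 1 - 1) = (ρ * L) ^ i := by rw [Nat.add_sub_cancel]
  calc ∑ z ∈ periodBox (d := d) N, ((L : ℝ) ^ d)⁻¹ * ∑ r : Fin d → Fin L,
          lnorm rem (((L : ℤ) ^ (j + 1 - (i + 1))) • z) (treeWord (boxVec L r)) ^ 2
      ≤ ∑ z ∈ periodBox (d := d) N, ((d : ℝ) * L) * ∑ v ∈ periodBox (d := d) L, ∑ κ : Fin d, ‖R (((L : ℤ) ^ (j + 1 - (i + 1))) • z + v) κ‖ ^ 2 :=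
        Finset.sum_le_sum fun z _ => hblock z
    _ ≤ ((d : ℝ) * L) * l2sq (periodBox (d := d) N') R := by rw [← Finset.mul_sum]; exact mul_le_mul_of_nonneg_left htile (by positivity)
    _ ≤ ((d : ℝ) * L) * (32 * K * Real.sqrt E * b * (ρ * L) ^ (i + 1 - 1)) ^ 2 := mul_le_mul_of_nonneg_left hl2R (by positivity)
    _ = ((d : ℝ) * L) * (1024 * K ^ 2 * b ^ 2 * ((L : ℝ) ^ 2 * ((L : ℝ) ^ 2 / (L : ℝ) ^ d)) ^ (i + 1 - 1) * E) := by
        rw [hgeo, Nat.add_sub_cancel]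
        have e1 : (32 * K * Real.sqrt E * b * (ρ * (L : ℝ)) ^ i) ^ 2 = 1024 * K ^ 2 * (Real.sqrt E ^ 2) * b ^ 2 * ((ρ ^ 2 * (L : ℝ) ^ 2) ^ i) := by
          rw [show (ρ ^ 2 * (L : ℝ) ^ 2) ^ i = ((ρ * (L : ℝ)) ^ i) ^ 2 by rw [← mul_pow, ← pow_mul, ← pow_mul, mul_comm 2 i]]
          ring
        rw [e1, Real.sq_sqrt hE0, hρ2]
        ring

/-! ## §3 The assembled ℓ²-over-corners letter of the remainder term -/

/-- **THE REMAINDER TERM OF THE FRAME DEFECT, SQUARED AND SUMMED OVER THE TOP CORNERS** (same regime): with `rem_m = ψ_m − QbarIter L m W X` and `PA_m(rem_m)(z) =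
L^{−d}Σ_r lnorm(rem_m; L^{j+1−m}•z, Γ_r)`,
`Σ_{z∈[0,N)^d} (Σ_{m≤j} PA_m(rem_m)(z))² ≤ (j+1)·dL·1024K²·b²·(Σ_{i<j} (L²ρ₂)^i)·l2sq X` — the level-0 term vanishes, Cauchy–Schwarz over the `j+1` levels, Jensen, §2.  In d = 4
(`L²ρ₂ = 1`) the right-hand side is `(j+1)·j·1024dLK²·(Mb)²·M⁻²·‖X‖²`; against the corner-spike weight `M⁻² = L^{−2(j+1)}` this is k-free (memo §4 S4). [folklore] -/
theorem sum_corners_sq_pathAvg_rem_le [Nonempty n] {L N : ℕ} (hL : 2 ≤ L) (hN : 1 ≤ N) (j : ℕ)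
    {W : Site d → Fin d → (Matrix n n ℂ)ˣ} {x : ℝ} (hWu : IsUnitaryCfg W) (hWP : IsPeriodicCfg W ((N * L ^ (j + 1) : ℕ) : ℤ))
    (hx : 0 ≤ x) (hsm : LevelSmall d L j x) (hWx : SmallField W x)
    {α₀ b : ℝ} (hα : 0 < α₀) (hα3 : C0 d * (2 * α₀) ≤ 1 / 3) (hα4 : 4 * (2 * α₀) ≤ c2' d L)
    (h52 : pdev W < α₀ * (((L : ℝ) ^ (j + 1))⁻¹) ^ 2) (hb : 0 ≤ b)
    {X : Site d → Fin d → Matrix n n ℂ} (hX : ∀ (y : Site d) (κ : Fin d), ‖X y κ‖ ≤ b) (hXP : IsPeriodicDir X ((N * L ^ (j + 1) : ℕ) : ℤ))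
    (hsmall : Real.exp (4 * (800 * ((d : ℝ) + 1) ^ 2 * ((d : ℝ) + 4)) * α₀)
      * (1 + 8 * (131072 * ((d : ℝ) + 1) ^ 2) * ((L : ℝ) ^ (j + 1) * b)) ≤ 2)
    (hc₃ : 4 * ((L : ℝ) ^ (j + 1) * b) ≤ c3 d L)
    (hK : 16 * (C1cov d * (L : ℝ) ^ 2 * Real.sqrt (d * (2 * (2 * L) + 1) ^ d)) * (L : ℝ) ^ (j + 1) * b ≤ Real.sqrt ((L : ℝ) ^ 2 / (L : ℝ) ^ d)) :
    ∑ z ∈ periodBox (d := d) N, (∑ m ∈ range (j + 1), ((L : ℝ) ^ d)⁻¹ * ∑ r : Fin d → Fin L,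
        lnorm (fun x' μ => Ad (avgIter L W m x' μ)⁻¹ (logCovIter L W (adField W X) m x' μ) - QbarIter L m W X x' μ)
          (((L : ℤ) ^ (j + 1 - m)) • z) (treeWord (boxVec L r))) ^ 2
      ≤ ((j : ℝ) + 1) * (((d : ℝ) * L) * (1024 * (C1cov d * (L : ℝ) ^ 2 * Real.sqrt (d * (2 * (2 * L) + 1) ^ d)) ^ 2 * b ^ 2
          * (∑ i ∈ range j, ((L : ℝ) ^ 2 * ((L : ℝ) ^ 2 / (L : ℝ) ^ d)) ^ i) * l2sq (periodBox (d := d) (N * L ^ (j + 1))) X)) := by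
  letI : CStarAlgebra (Matrix n n ℂ) := {}
  have hL1 : 1 ≤ L := by omega
  set k : ℕ := j + 1 with hk
  set PA : ℕ → Site d → ℝ := fun m z => ((L : ℝ) ^ d)⁻¹ * ∑ r : Fin d → Fin L,
      lnorm (fun x' μ => Ad (avgIter L W m x' μ)⁻¹ (logCovIter L W (adField W X) m x' μ) - QbarIter L m W X x' μ)
        (((L : ℤ) ^ (k - m)) • z) (treeWord (boxVec L r)) with hPA
  set SQ : ℕ → Site d → ℝ := fun m z => ((L : ℝ) ^ d)⁻¹ * ∑ r : Fin d → Fin L,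
      lnorm (fun x' μ => Ad (avgIter L W m x' μ)⁻¹ (logCovIter L W (adField W X) m x' μ) - QbarIter L m W X x' μ)
        (((L : ℤ) ^ (k - m)) • z) (treeWord (boxVec L r)) ^ 2 with hSQ
  set K : ℝ := C1cov d * (L : ℝ) ^ 2 * Real.sqrt (d * (2 * (2 * L) + 1) ^ d) with hKdef
  set σ : ℝ := (L : ℝ) ^ 2 * ((L : ℝ) ^ 2 / (L : ℝ) ^ d) with hσ
  set E : ℝ := l2sq (periodBox (d := d) (N * L ^ k)) X with hE
  set A : ℝ := ((d : ℝ) * L) * (1024 * K ^ 2 * b ^ 2) with hA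
  have hE0 : 0 ≤ E := l2sq_nonneg _ _
  have hσ0 : 0 ≤ σ := by positivity
  have hA0 : 0 ≤ A := by positivity
  show ∑ z ∈ periodBox (d := d) N, (∑ m ∈ range k, PA m z) ^ 2 ≤ ((j : ℝ) + 1) * (((d : ℝ) * L) * (1024 * K ^ 2 * b ^ 2 * (∑ i ∈ range j, σ ^ i) * E))
  -- the level-0 functional vanishes
  have hPA0z : ∀ z, PA 0 z = 0 := by
    intro z; simp only [hPA]
    have : ∀ r : Fin d → Fin L, lnorm (fun x' μ => Ad (avgIter L W 0 x' μ)⁻¹ (logCovIter L W (adField W X) 0 x' μ) - QbarIter L 0 W X x' μ)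
        (((L : ℤ) ^ (k - 0)) • z) (treeWord (boxVec L r)) = 0 := by
      intro r
      have e : (fun x' μ => Ad (avgIter L W 0 x' μ)⁻¹ (logCovIter L W (adField W X) 0 x' μ) - QbarIter L 0 W X x' μ) = fun _ _ => (0 : Matrix n n ℂ) := by
        funext x' μ; exact rem_zero_level L W X x' μ
      rw [e]
      clear e
      generalize (((L : ℤ) ^ (k - 0)) • z : Site d) = y
      induction treeWord (boxVec L r) generalizing y with
      | nil => exact lnorm_nil _ _
      | cons l w ih => rw [lnorm_cons, ih, norm_zero, zero_add]
    rw [Finset.sum_congr rfl fun r _ => this r, Finset.sum_const_zero, mul_zero]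
  -- Cauchy–Schwarz over the levels, Jensen per level
  have hPAnn : ∀ m z, 0 ≤ PA m z := fun m z => by
    simp only [hPA]; exact mul_nonneg (by positivity) (Finset.sum_nonneg fun r _ => lnorm_nonneg _ _ _)
  have hcs : ∀ z, (∑ m ∈ range k, PA m z) ^ 2 ≤ (k : ℝ) * ∑ m ∈ range k, PA m z ^ 2 := fun z => by
    have h := sq_sum_le_card_mul_sum_sq (s := range k) (f := fun m => PA m z)
    rw [Finset.card_range] at h
    exact h
  have hj : ∀ m z, PA m z ^ 2 ≤ SQ m z := fun m z => pathAvg_sq_le_sqAvg hL1 _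
  -- level by level (§2), the level `0` contributing nothing
  have hlev : ∀ m ∈ range k, ∑ z ∈ periodBox (d := d) N, SQ m z ≤ if m = 0 then 0 else A * σ ^ (m - 1) * E := by
    intro m hm
    have hmk := Finset.mem_range.mp hm
    by_cases hm0 : m = 0
    · subst hm0
      rw [if_pos rfl]
      refine le_of_eq (Finset.sum_eq_zero fun z _ => ?_)
      have h0 := hj 0 z
      rw [hPA0z z] at h0
      -- `SQ 0 z = 0`: every term vanishes like `PA 0 z`
      simp only [hSQ]
      have : ∀ r : Fin d → Fin L, lnorm (fun x' μ => Ad (avgIter L W 0 x' μ)⁻¹ (logCovIter L W (adField W X) 0 x' μ) - QbarIter L 0 W X x' μ)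
          (((L : ℤ) ^ (k - 0)) • z) (treeWord (boxVec L r)) = 0 := by
        intro r
        have e : (fun x' μ => Ad (avgIter L W 0 x' μ)⁻¹ (logCovIter L W (adField W X) 0 x' μ) - QbarIter L 0 W X x' μ) = fun _ _ => (0 : Matrix n n ℂ) := by
          funext x' μ; exact rem_zero_level L W X x' μ
        rw [e]
        clear e
        generalize (((L : ℤ) ^ (k - 0)) • z : Site d) = y
        induction treeWord (boxVec L r) generalizing y with
        | nil => exact lnorm_nil _ _
        | cons l w ih => rw [lnorm_cons, ih, norm_zero, zero_add]
      rw [Finset.sum_congr rfl fun r _ => by rw [this r], Finset.sum_congr rfl fun r _ => by rw [zero_pow two_ne_zero], Finset.sum_const_zero, mul_zero]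
    · rw [if_neg hm0]
      have h := sum_corners_sqAvg_rem_le hL hN j hWu hWP hx hsm hWx hα hα3 hα4 h52 hb hX hXP hsmall hc₃ hK (m := m) (by omega) (by omega)
      simp only [hSQ, hA, hKdef, hσ, hE, hk] at h ⊢
      linarith
  -- the level sum of the per-level bounds is the displayed geometric-type sum
  have hsumlev : ∑ m ∈ range k, (if m = 0 then (0 : ℝ) else A * σ ^ (m - 1) * E) = A * (∑ i ∈ range j, σ ^ i) * E := by
    rw [hk, Finset.sum_range_succ']
    simp only [Nat.succ_ne_zero, if_false, if_true, Nat.add_sub_cancel, add_zero]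
    rw [Finset.mul_sum, Finset.sum_mul]
  have hS0 : 0 ≤ A * (∑ i ∈ range j, σ ^ i) * E := mul_nonneg (mul_nonneg hA0 (Finset.sum_nonneg fun i _ => pow_nonneg hσ0 i)) hE0
  calc ∑ z ∈ periodBox (d := d) N, (∑ m ∈ range k, PA m z) ^ 2
      ≤ ∑ z ∈ periodBox (d := d) N, (k : ℝ) * ∑ m ∈ range k, SQ m z :=
        Finset.sum_le_sum fun z _ => (hcs z).trans (mul_le_mul_of_nonneg_left (Finset.sum_le_sum fun m _ => hj m z) (Nat.cast_nonneg k))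
    _ = (k : ℝ) * ∑ m ∈ range k, ∑ z ∈ periodBox (d := d) N, SQ m z := by rw [← Finset.mul_sum, Finset.sum_comm]
    _ ≤ (k : ℝ) * ∑ m ∈ range k, (if m = 0 then (0 : ℝ) else A * σ ^ (m - 1) * E) :=
        mul_le_mul_of_nonneg_left (Finset.sum_le_sum hlev) (Nat.cast_nonneg k)
    _ = ((j : ℝ) + 1) * (((d : ℝ) * L) * (1024 * K ^ 2 * b ^ 2 * (∑ i ∈ range j, σ ^ i) * E)) := by
        rw [hsumlev, hk, hA]; push_cast; ring

end

end Summit.QuantumFields.BalabanUV.T4Continuum.NE7AccumulatedFrameDefectRemCornerSums
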